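import Literature.Analysis.FluidPDE.RusinSverakWeakStability
import Literature.Analysis.FunctionSpaces.FourierSobolevNormEmbeddingProofs
import HarnessLib

/-!
# Rusin–Šverák, Cor. 4.3, from the two PDE facts alone (Sobolev embedding discharged)

Analysis/FluidPDE proof file, definitions-free; sibling of `RusinSverakWeakStability.lean`
(named facts `NS.rusin_sverak_singular_point_of_blowup` — "finite `T_max` forces a singular
point", Rusin–Šverák, J. Funct. Anal. 260 (2011) = arXiv:0911.0500, §4 pp. 6–7 — and
`NS.rusin_sverak_weak_limit_of_singular_points` — Cor. 4.2, p. 8 — together with the proved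
reduction `NS.rusin_sverak_weak_limit_blowup_of_singular_points : N → C →
eLpNorm_three_le_eHomSobolevSeminorm_half → rusin_sverak_weak_limit_blowup`).

The third hypothesis there, the tree's Sobolev-embedding fact
`Literature.Analysis.FunctionSpaces.eLpNorm_three_le_eHomSobolevSeminorm_half` (`FunctionSpaces/FourierSobolevNorm.lean`;
Bahouri–Chemin–Danchin 2011, Thm. 1.38: `Ḣ^{1/2}(ℝ³) ⊂ L³(ℝ³)`), is now **discharged**
(`Literature.Analysis.FunctionSpaces.eLpNorm_three_le_eHomSobolevSeminorm_half_holds`,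
`FunctionSpaces/FourierSobolevNormEmbeddingProofs.lean`, the frequency-splitting proof of
Chemin–Xu 1997). This file records the resulting reductions taking the two PDE facts only:

* `NS.rusin_sverak_weak_limit_blowup_of_singular_points'`,
* `NS.rusin_sverak_minimal_data_compact_of_singular_points'` — Cor. 4.3, second clause
  (`Literature.Analysis.FluidPDE.rusin_sverak_minimal_data_compact`, `RusinSverakCompactness.lean`),
* `NS.rusin_sverak_minimal_blowup_of_singular_points'` — Cor. 4.3, first clause
  (`Literature.Analysis.FluidPDE.rusin_sverak_minimal_blowup`, `MildSolutions.lean`, ns.S14).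

State of the DAG below `rusin_sverak_minimal_data_compact` after this file: proved modulo the
two named facts `NS.rusin_sverak_singular_point_of_blowup` (ε-regularity level: Rusin–Šverák
§4 p. 6 with Prop. 2.1, Prop. 4.1, Thm. 4.1) and `NS.rusin_sverak_weak_limit_of_singular_points`
(Rusin–Šverák's Cor. 4.2: Thm. 4.2 + Lemma 4.1 + Prop. 2.2 + Lemma 2.1 + Thm. 4.1).

## References

* W. Rusin, V. Šverák, *Minimal initial data for potential Navier–Stokes singularities*,
  J. Funct. Anal. 260 (2011) 879–891 = arXiv:0911.0500, §4 (pp. 6–8: Thm. 4.1, Prop. 4.1,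
  Thm. 4.2, Cor. 4.2, Cor. 4.3).
* H. Bahouri, J.-Y. Chemin, R. Danchin, *Fourier Analysis and Nonlinear PDE* (2011), Thm. 1.38.
-/

noncomputable section

namespace Literature.Analysis.FluidPDE

/-- **Rusin–Šverák's weak-limit blow-up (`rusin_sverak_weak_limit_blowup`) from the two PDE
facts alone**: `rusin_sverak_weak_limit_blowup_of_singular_points` with the Sobolev embedding
`Ḣ^{1/2}(ℝ³) ⊂ L³(ℝ³)` supplied by its discharge
`Literature.Analysis.FunctionSpaces.eLpNorm_three_le_eHomSobolevSeminorm_half_holds`.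
[cite: RusinSverak2011, proof of Cor. 4.3 (arXiv:0911.0500 p. 8) with Cor. 4.2 and §4 p. 6] -/
theorem rusin_sverak_weak_limit_blowup_of_singular_points'
    (hN : rusin_sverak_singular_point_of_blowup) (hC : rusin_sverak_weak_limit_of_singular_points) :
    rusin_sverak_weak_limit_blowup :=
  rusin_sverak_weak_limit_blowup_of_singular_points hN hC
    FunctionSpaces.eLpNorm_three_le_eHomSobolevSeminorm_half_holds

/-- **Rusin–Šverák, Cor. 4.3, second clause (`rusin_sverak_minimal_data_compact`: the set of
minimal blow-up data is compact modulo scalings and translations) from the two PDE facts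
alone** (finite `T_max` forces a singular point; weak stability of singular points, Cor. 4.2).
[cite: RusinSverak2011, Cor. 4.3 (arXiv:0911.0500 p. 8)] -/
theorem rusin_sverak_minimal_data_compact_of_singular_points'
    (hN : rusin_sverak_singular_point_of_blowup) (hC : rusin_sverak_weak_limit_of_singular_points) :
    rusin_sverak_minimal_data_compact :=
  rusin_sverak_minimal_data_compact_of_weak_limit_blowup
    (rusin_sverak_weak_limit_blowup_of_singular_points' hN hC)

/-- **Rusin–Šverák, Cor. 4.3, first clause (`rusin_sverak_minimal_blowup`, ns.S14: if some
datum blows up then a datum of minimal `Ḣ^{1/2}`-norm `ρ_max` blows up) from the two PDE facts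
alone** (finite `T_max` forces a singular point; weak stability of singular points, Cor. 4.2).
[cite: RusinSverak2011, Cor. 4.3 (arXiv:0911.0500 p. 8)] -/
theorem rusin_sverak_minimal_blowup_of_singular_points'
    (hN : rusin_sverak_singular_point_of_blowup) (hC : rusin_sverak_weak_limit_of_singular_points) :
    rusin_sverak_minimal_blowup :=
  rusin_sverak_minimal_blowup_of_weak_limit_blowup
    (rusin_sverak_weak_limit_blowup_of_singular_points' hN hC)

end Literature.Analysis.FluidPDE
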